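import Literature.AlgebraicGeometry.HodgeTheory.SupportedClassesPrimeDivisorLocal
import Literature.AlgebraicGeometry.HodgeTheory.LefschetzOperatorAlgebraicClasses
import Summits.HodgeConjecture.HodgeConjecture.Theorems.HeckePrymWeilSummitOffWeilSectorCupProductInstances
import HarnessLib

/-!
# Line `motivated-anchor-split` (crux `HeckePrymWeil.SummitOffWeilSector`, stmt-HodgeConjecture-14374) — Stub 4a: `Nᵃ H²ᵃ ∪ N¹ H² ⊆ Nᵃ⁺¹ H²ᵃ⁺²` on every smooth projective complex variety

The registered stub `stub_cupProductAlgebraicDivisor`: for `V` smooth projective over `ℂ`,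
`x ∈ Nᵃ H²ᵃ(V(ℂ); ℂ)` and `y ∈ N¹ H²(V(ℂ); ℂ)` imply `x ∪ y ∈ Nᵃ⁺¹` (C. Voisin, *Hodge Theory II*,
Prop. 9.20, the case of a divisor class: the divisor moves in its linear system, W. Fulton,
*Intersection Theory*, §2.3–2.4 and Cor. 19.2; no Chow moving lemma). The tree reduces it
(`cupProduct_mem_algebraicClasses_one_of_forall_primeDivisor'`, file
`HodgeTheory/AlgebraicClassesCupDivisor`: bilinearity, irreducible supports, the cup product with
supports, strict specialisation, semipurity) to one statement about a PRIME DIVISOR `W ⊆ V` and a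
point `v ∈ W`: Zariski-closed `W', T ∌ v` and a class `ψ` dying off `T` with
`ker (H²(V) → H²(V ∖ W)) ≤ ℂ · ψ + ker (H²(V) → H²(V ∖ W'))`. The tree's
`ker_restrictCompl_le_of_mem_primeDivisor` (file `HodgeTheory/SupportedClassesPrimeDivisorLocal`: the
classes supported on `W` die on the chart `O ∋ v` of a local equation of the Cartier divisor `W` —
local factoriality, GAGA at simple points, and the topological Lelong–Poincaré formula
`[j⁻¹(0)] = j^*[0] = 0`) gives this with `W' = T = V ∖ O` and `ψ = 0`.

* `stub_cupProductAlgebraicDivisor` — the stub, unconditionally, for every smooth projective complex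
  `V` and every `a`.

With `cupProduct_algebraicClasses_of_closedRange` (file `…CupProductInstances`) this leaves of
`Voisin2003_cupProduct_algebraicClasses` exactly the higher bidegrees `2 ≤ a`, `2 ≤ b`, `a + b + 2 ≤ d`
(`stub_cupProductAlgebraicHigher`), and it makes conjecture `B` below the middle degree unconditional
(`standardConjectureBStar_of_le_middle`, file `…LefschetzBBelowMiddle`).

## References

* [VoisinHodgeII2003] C. Voisin, Hodge Theory and Complex Algebraic Geometry II (CUP 2003), §9.2.3
  Lemma 9.18 (proof), §9.2.4 Prop. 9.20.
* [Fulton1998] W. Fulton, Intersection Theory, 2nd ed. (1998), §2.3–2.4, §19.2 Cor. 19.2.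
-/

noncomputable section

-- every declaration of this problem lives in `Summit.HodgeConjecture.HodgeConjecture.…` (summit = sub-problem)
set_option linter.dupNamespace false

open CategoryTheory AlgebraicGeometry MonoidalCategory CartesianMonoidalCategory
  Literature.AlgebraicGeometry.Motives Literature.AlgebraicGeometry.HodgeTheory
  Literature.AlgebraicTopology.SingularHomology Literature.Geometry.Kaehler

namespace Summit.HodgeConjecture.HodgeConjecture.Theorems

/-- **Stub 4a of line `motivated-anchor-split` — `Nᵃ H²ᵃ ∪ N¹ H² ⊆ Nᵃ⁺¹ H²ᵃ⁺²` on every smooth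
projective complex variety** (C. Voisin, *Hodge Theory II*, Prop. 9.20, `cl(Z · D) = cl(Z) ∪ cl(D)`
for a divisor `D`, which moves in its linear system: Fulton §2.3–2.4, Cor. 19.2). For `V` smooth
projective over `ℂ`, `x ∈ algebraicClasses V a` and `y ∈ algebraicClasses V 1`,
`x ∪ y ∈ algebraicClasses V (a + 1)`. Proof: the tree's reduction to prime divisors
`cupProduct_mem_algebraicClasses_one_of_forall_primeDivisor'`, whose hypothesis at a prime divisor
`W ∋ v` is met with `W' = T = V ∖ O` and `ψ = 0` for the Zariski neighbourhood `O ∋ v` of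
`ker_restrictCompl_le_of_mem_primeDivisor` on which every class supported on `W` dies.
[cite: VoisinHodgeII2003, §9.2.3 Lemma 9.18 (proof) and §9.2.4 Prop. 9.20]
[cite: Fulton1998, §2.3–2.4 and §19.2 Cor. 19.2] -/
theorem stub_cupProductAlgebraicDivisor :
    ∀ ⦃d : ℕ⦄ ⦃V : SchemeOver ℂ⦄, IsSmoothProjective d V →
      ∀ ⦃a : ℕ⦄ ⦃x : complexBetti V (2 * a)⦄ ⦃y : complexBetti V (2 * 1)⦄,
        x ∈ algebraicClasses V a → y ∈ algebraicClasses V 1 →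
          cupProduct (two_mul_add_two_mul a 1) x y ∈ algebraicClasses V (a + 1) := by
  intro d V hV a x y hx hy
  refine cupProduct_mem_algebraicClasses_one_of_forall_primeDivisor' hV
    (fun W hW hWi hη v hv ↦ ?_) hx hy
  obtain ⟨O, hvO, hle⟩ := ker_restrictCompl_le_of_mem_primeDivisor hV hW hWi hη hv
  refine ⟨(O : Set V.left)ᶜ, (O : Set V.left)ᶜ, O.isOpen.isClosed_compl, O.isOpen.isClosed_compl,
    fun h ↦ h hvO, fun h ↦ h hvO, 0, Submodule.zero_mem _, fun z hz ↦ ?_⟩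
  exact Submodule.mem_sup_right (hle hz)

end Summit.HodgeConjecture.HodgeConjecture.Theorems

end
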